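import Literature.Probability.LatticeModels.ConformalCovariance
import Literature.Barriers.CriticalPhenomena.ScaleCovarianceNotMoebius

/-!
# `MoebiusLimitOfTwoPointLaw` (crux `stmt-CriticalPhenomena-4801`): the two-shell kinematics, and
# the group lemma NEEDS translation invariance (negative-side support)

Support file of the crux disprover (cdisprove seat, cycle 2) for the crux line of card
`two-shell-exchange-markov` (`Cruxes/MoebiusLimitOfTwoPointLaw/SketchIdeator2R1.lean`). The sets
`sphereInversionCovariant Δ` and `twoShellExchange Δ` below are the card's predicates
`IsSphereInversionCovariant Δ S` / `TwoShellExchange Δ S` as sets of families (`S ∈ _ ↔ _` by `Iff.rfl`).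
Proved here, `sorry`-free:

* the card's "provable now" kinematic stubs ARE true: `mem_sphereInversionCovariant_of_scale_of_inversion`
  (A1 `KinematicNecessity`), `mem_twoShellExchange_of_mem_sphereInversionCovariant` (A2
  `SphereInversionGivesExchange`), `twoPoint_exchange_of_twoPointLaw` (A3 `BaseCaseFromTwoPointLaw`);
* `not_groupLemma_without_translation` — the card's group lemma P2 ("normalised + continuous off the
  diagonals + translation invariant + covariant under every origin-centred sphere inversion ⇒ Möbius
  covariant") is FALSE once translation invariance is dropped, for every weight `Δ`: the two-point family
  `A_Δ(x,y) = ‖x−y‖^{-2Δ}·(1 + (⟪x,e₁⟫‖y‖ + ⟪y,e₁⟫‖x‖)/(‖x‖²+‖y‖²))` (`anisoFamily Δ`) is continuous off the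
  diagonal, covariant under EVERY `ι_λ : x ↦ λx/‖x‖²` and scale covariant with dimension `Δ`, but not `O(3)`
  invariant (`x ↦ −x` flips the anisotropy; so does the proper half-turn about `e₃` — that variant is in the
  crux workfile `Cruxes/MoebiusLimitOfTwoPointLaw/Disproof.lean`). Moral: the `O(3)` half of P2
  must come from conjugating `ι` by translations; sphere inversions about ONE centre (with dilations) form an
  abelian group preserving every ray.
-/

noncomputable section

namespace Summit.CriticalPhenomena.Ising3DConformalLimit.Theorems.MoebiusLimitOfTwoPointLaw.Negative

open Literature.Probability.LatticeModels Filter Topology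
open Literature.Barriers.CriticalPhenomena.ScaleNotMoebius (twoPt twoPt_pos twoPt_smul twoPt_inversion
  twoPt_map twoPt_add axisUnit norm_axisUnit axisUnit_ne_zero injective_fin_two_iff continuousOn_twoPt)

/-! ## §1 Two-shell kinematics (stubs A1–A3 of the card, proved) -/

/-- Families covariant under every origin-centred sphere inversion `x ↦ λx/‖x‖²` (`λ > 0`) with weight `Δ`
(the card's `IsSphereInversionCovariant Δ S`, as a set). -/
def sphereInversionCovariant (Δ : ℝ) : Set (CorrFamily 3) :=
  {S | ∀ (n : ℕ) (lam : ℝ), 0 < lam → ∀ x : Fin n → EuclideanSpace ℝ (Fin 3), (∀ i, x i ≠ 0) →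
    S n (fun i => (lam / ‖x i‖ ^ 2) • x i) = lam ^ (-(n : ℝ) * Δ) * (∏ i, ‖x i‖ ^ (2 * Δ)) * S n x}

/-- Families obeying the two-shell exchange law `E_{k,m}` with weight `Δ` (the card's `TwoShellExchange Δ S`,
as a set). -/
def twoShellExchange (Δ : ℝ) : Set (CorrFamily 3) :=
  {S | ∀ (n : ℕ) (a b : ℝ), 0 < a → 0 < b → ∀ (u : Fin n → EuclideanSpace ℝ (Fin 3)) (inner : Fin n → Bool),
    (∀ i, ‖u i‖ = 1) →
      S n (fun i => (if inner i then b else a) • u i)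
        = (a / b) ^ ((((Finset.univ.filter fun i => inner i = true).card : ℝ)
              - ((Finset.univ.filter fun i => inner i = false).card : ℝ)) * Δ)
          * S n (fun i => (if inner i then a else b) • u i)}

/-- The sphere inversion `x ↦ λx/‖x‖²` is `λ •` the unit inversion of Mathlib. -/
theorem sphereInversion_eq_smul_inversion (lam : ℝ) (x : EuclideanSpace ℝ (Fin 3)) :
    (lam / ‖x‖ ^ 2) • x = lam • EuclideanGeometry.inversion 0 1 x := by
  rw [EuclideanGeometry.inversion, dist_eq_norm, vsub_eq_sub, sub_zero, vadd_eq_add, add_zero,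
    smul_smul]
  congr 1
  rw [div_pow, one_pow]
  ring

/-- Norm of the sphere-inverted point: `‖λx/‖x‖²‖ = λ/‖x‖` (`λ > 0`, `x ≠ 0`). -/
theorem norm_sphereInversion {lam : ℝ} (hlam : 0 < lam) {x : EuclideanSpace ℝ (Fin 3)} (hx : x ≠ 0) :
    ‖(lam / ‖x‖ ^ 2) • x‖ = lam / ‖x‖ := by
  have hn : 0 < ‖x‖ := norm_pos_iff.2 hx
  rw [norm_smul, Real.norm_eq_abs, abs_of_pos (by positivity)]
  field_simp

/-- The sphere inversion is injective on nonzero vectors (for `λ ≠ 0`). -/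
theorem sphereInversion_injective {lam : ℝ} (hlam : lam ≠ 0) {x y : EuclideanSpace ℝ (Fin 3)}
    (h : (lam / ‖x‖ ^ 2) • x = (lam / ‖y‖ ^ 2) • y) : x = y := by
  rw [sphereInversion_eq_smul_inversion, sphereInversion_eq_smul_inversion] at h
  exact EuclideanGeometry.inversion_injective (0 : EuclideanSpace ℝ (Fin 3)) one_ne_zero (smul_right_injective (EuclideanSpace ℝ (Fin 3)) hlam h)

/-- **A1 (`KinematicNecessity`) is TRUE.** Scale covariance + unit-inversion covariance ⇒ covariance under
every origin-centred sphere inversion (`ι_λ = λ • ι₁`). -/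
theorem mem_sphereInversionCovariant_of_scale_of_inversion {Δ : ℝ} {S : CorrFamily 3}
    (hsc : IsScaleCovariant Δ S) (hinv : IsInversionCovariant Δ S) : S ∈ sphereInversionCovariant Δ := by
  simp only [sphereInversionCovariant, Set.mem_setOf_eq]
  intro n lam hlam x hx
  have h1 : (fun i => (lam / ‖x i‖ ^ 2) • x i) =
      fun i => lam • EuclideanGeometry.inversion 0 1 (x i) := by
    funext i; exact sphereInversion_eq_smul_inversion lam (x i)
  rw [h1, hsc n lam hlam (fun i => EuclideanGeometry.inversion 0 1 (x i)), hinv n x hx, mul_assoc]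

/-- **A2 (`SphereInversionGivesExchange`) is TRUE.** Sphere-inversion covariance ⇒ the two-shell exchange law
(`ι_{ab}` swaps the shells of radii `a` and `b`; the weight is `(ab)^{-nΔ} a^{2kΔ} b^{2mΔ} = (a/b)^{(k-m)Δ}`). -/
theorem mem_twoShellExchange_of_mem_sphereInversionCovariant {Δ : ℝ} {S : CorrFamily 3}
    (hS : S ∈ sphereInversionCovariant Δ) : S ∈ twoShellExchange Δ := by
  simp only [sphereInversionCovariant, Set.mem_setOf_eq] at hS
  simp only [twoShellExchange, Set.mem_setOf_eq]
  intro n a b ha hb u inner hu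
  -- the configuration with inner points at radius `a`, outer at radius `b`
  set y : Fin n → EuclideanSpace ℝ (Fin 3) := fun i => (if inner i then a else b) • u i with hy
  have hny : ∀ i, ‖y i‖ = if inner i then a else b := by
    intro i
    simp only [hy]
    split_ifs with h
    · rw [norm_smul, Real.norm_eq_abs, abs_of_pos ha, hu i, mul_one]
    · rw [norm_smul, Real.norm_eq_abs, abs_of_pos hb, hu i, mul_one]
  have hy0 : ∀ i, y i ≠ 0 := by
    intro i
    rw [← norm_pos_iff, hny i]
    split_ifs <;> assumption
  have key := hS n (a * b) (mul_pos ha hb) y hy0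
  -- `ι_{ab} y` is the exchanged configuration
  have himg : (fun i => (a * b / ‖y i‖ ^ 2) • y i) = fun i => (if inner i then b else a) • u i := by
    funext i
    rw [hny i]
    simp only [hy]
    split_ifs with h
    · rw [smul_smul]; congr 1; field_simp
    · rw [smul_smul]; congr 1; field_simp
  rw [himg] at key
  rw [key]
  congr 1
  -- the weight
  have hprod : (∏ i, ‖y i‖ ^ (2 * Δ)) =
      (a ^ (2 * Δ)) ^ (Finset.univ.filter fun i => inner i = true).card *
        (b ^ (2 * Δ)) ^ (Finset.univ.filter fun i => inner i = false).card := by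
    have h1 : (∏ i, ‖y i‖ ^ (2 * Δ)) = ∏ i, (if inner i = true then a ^ (2 * Δ) else b ^ (2 * Δ)) := by
      refine Finset.prod_congr rfl fun i _ => ?_
      rw [hny i]
      split_ifs <;> rfl
    rw [h1, Finset.prod_ite, Finset.prod_const, Finset.prod_const]
    simp only [Bool.not_eq_true]
  set k : ℕ := (Finset.univ.filter fun i => inner i = true).card with hk
  set m : ℕ := (Finset.univ.filter fun i => inner i = false).card with hm
  have hkm : (k : ℝ) + m = n := by
    have h := Finset.card_filter_add_card_filter_not (s := (Finset.univ : Finset (Fin n)))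
      (fun i => inner i = true)
    simp only [Finset.card_univ, Fintype.card_fin, Bool.not_eq_true] at h
    rw [← hk, ← hm] at h
    exact_mod_cast h
  rw [hprod, ← Real.rpow_mul_natCast ha.le, ← Real.rpow_mul_natCast hb.le,
    Real.mul_rpow ha.le hb.le]
  have e1 : -(n : ℝ) * Δ + 2 * Δ * k = (k - m) * Δ := by rw [← hkm]; ring
  have e2 : -(n : ℝ) * Δ + 2 * Δ * m = -((k - m) * Δ) := by rw [← hkm]; ring
  calc a ^ (-(n : ℝ) * Δ) * b ^ (-(n : ℝ) * Δ) * (a ^ (2 * Δ * k) * b ^ (2 * Δ * m))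
      = (a ^ (-(n : ℝ) * Δ) * a ^ (2 * Δ * k)) * (b ^ (-(n : ℝ) * Δ) * b ^ (2 * Δ * m)) := by ring
    _ = a ^ ((k - m) * Δ) * b ^ (-((k - m) * Δ)) := by
        rw [← Real.rpow_add ha, ← Real.rpow_add hb, e1, e2]
    _ = (a / b) ^ (((k : ℝ) - m) * Δ) := by
        rw [Real.rpow_neg hb.le, Real.div_rpow ha.le hb.le, div_eq_mul_inv]

/-- `‖b u − a v‖ = ‖a u − b v‖` for unit `u, v`. -/
theorem norm_exchange_units (a b : ℝ) {u v : EuclideanSpace ℝ (Fin 3)} (hu : ‖u‖ = 1) (hv : ‖v‖ = 1) :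
    ‖b • u - a • v‖ = ‖a • u - b • v‖ := by
  have h1 : ‖b • u - a • v‖ ^ 2 = ‖a • u - b • v‖ ^ 2 := by
    rw [@norm_sub_sq_real, @norm_sub_sq_real, norm_smul, norm_smul, norm_smul, norm_smul, hu, hv,
      real_inner_smul_left, real_inner_smul_right, real_inner_smul_left, real_inner_smul_right]
    simp only [Real.norm_eq_abs, mul_one, sq_abs]
    ring
  exact (pow_left_inj₀ (norm_nonneg _) (norm_nonneg _) two_ne_zero).1 h1

/-- **A3 (`BaseCaseFromTwoPointLaw`) is TRUE** (its hypotheses `0 < a`, `0 < b` are not even needed). The exact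
two-point law gives the `(1,1)` member of the hierarchy. -/
theorem twoPoint_exchange_of_twoPointLaw (c Δ : ℝ) (S : CorrFamily 3)
    (hS : ∀ a b : EuclideanSpace ℝ (Fin 3), a ≠ b → S 2 ![a, b] = c * ‖a - b‖ ^ (-(2 * Δ)))
    (a b : ℝ) (u v : EuclideanSpace ℝ (Fin 3)) (hu : ‖u‖ = 1) (hv : ‖v‖ = 1)
    (hne : a • u ≠ b • v) : S 2 ![b • u, a • v] = S 2 ![a • u, b • v] := by
  have hnorm := norm_exchange_units a b hu hv
  have hne' : b • u ≠ a • v := by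
    intro h
    apply hne
    rw [← sub_eq_zero, ← norm_eq_zero, ← hnorm, norm_eq_zero, sub_eq_zero]
    exact h
  rw [hS _ _ hne', hS _ _ hne, hnorm]

/-! ## §2 The group lemma needs translation invariance

`GroupLemma` (P2 of the card): normalised + continuous off the diagonals + translation invariant + `S ∈
sphereInversionCovariant Δ` ⇒ `IsMoebiusCovariant Δ S`. Drop translation invariance and it is false, for every
`Δ` (`not_groupLemma_without_translation`, `groupLemma_hypotheses_without_translation_insufficient`). -/

/-- The anisotropy factor `1 + (⟪x,e₁⟫‖y‖ + ⟪y,e₁⟫‖x‖)/(‖x‖² + ‖y‖²)` — invariant under every origin-centred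
sphere inversion and every dilation, continuous off `(0,0)`, odd part flipped by `x ↦ −x`. -/
def aniso (x y : EuclideanSpace ℝ (Fin 3)) : ℝ := 1 + (inner ℝ x axisUnit * ‖y‖ + inner ℝ y axisUnit * ‖x‖) / (‖x‖ ^ 2 + ‖y‖ ^ 2)

/-- The anisotropic two-point function `‖x−y‖^{-2Δ} · aniso x y` (zero on the diagonal). -/
def anisoPair (Δ : ℝ) (x y : EuclideanSpace ℝ (Fin 3)) : ℝ := if x = y then 0 else twoPt Δ x y * aniso x y

/-- The witness family: `anisoPair Δ` at `n = 2`, zero in every other arity. -/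
def anisoFamily (Δ : ℝ) : CorrFamily 3 := fun n =>
  match n with
  | 2 => fun x => anisoPair Δ (x 0) (x 1)
  | _ => fun _ => 0

/-- The witness at arity `2`. -/
theorem anisoFamily_two (Δ : ℝ) (x : Fin 2 → EuclideanSpace ℝ (Fin 3)) : anisoFamily Δ 2 x = anisoPair Δ (x 0) (x 1) := rfl

/-- The witness vanishes in every arity `≠ 2`. -/
theorem anisoFamily_ne_two (Δ : ℝ) {n : ℕ} (hn : n ≠ 2) (x : Fin n → EuclideanSpace ℝ (Fin 3)) : anisoFamily Δ n x = 0 := by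
  match n, hn with
  | 0, _ => rfl
  | 1, _ => rfl
  | 2, h => exact absurd rfl h
  | n + 3, _ => rfl

/-- Normalisation: the witness vanishes off `NonCoincident`. -/
theorem anisoFamily_eq_zero_of_not_mem (Δ : ℝ) (n : ℕ) (z : Fin n → EuclideanSpace ℝ (Fin 3)) (hz : z ∉ NonCoincident 3 n) :
    anisoFamily Δ n z = 0 := by
  by_cases hn : n = 2
  · subst hn
    rw [anisoFamily_two, anisoPair, if_pos]
    by_contra h01
    exact hz ((mem_nonCoincident z).2 ((injective_fin_two_iff z).2 h01))
  · exact anisoFamily_ne_two Δ hn z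

/-- `aniso` is continuous off the doubly-degenerate point `x = y = 0`, in particular off the diagonal. -/
theorem continuousOn_aniso :
    ContinuousOn (fun x : Fin 2 → EuclideanSpace ℝ (Fin 3) => aniso (x 0) (x 1)) {x | x 0 ≠ x 1} := by
  unfold aniso
  refine continuousOn_const.add (ContinuousOn.div ?_ ?_ ?_)
  · fun_prop
  · fun_prop
  · intro x hx h0
    have h1 : ‖x 0‖ ^ 2 = 0 := by nlinarith [sq_nonneg ‖x 0‖, sq_nonneg ‖x 1‖]
    have h2 : ‖x 1‖ ^ 2 = 0 := by nlinarith [sq_nonneg ‖x 0‖, sq_nonneg ‖x 1‖]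
    rw [sq_eq_zero_iff, norm_eq_zero] at h1 h2
    exact hx (h1.trans h2.symm)

/-- Continuity of the witness on non-coincident configurations, every arity. -/
theorem continuousOn_anisoFamily (Δ : ℝ) (n : ℕ) :
    ContinuousOn (anisoFamily Δ n) (NonCoincident 3 n) := by
  by_cases hn : n = 2
  · subst hn
    have hset : NonCoincident 3 2 = {x : Fin 2 → EuclideanSpace ℝ (Fin 3) | x 0 ≠ x 1} := by
      ext x; rw [mem_nonCoincident, injective_fin_two_iff]; rfl
    rw [hset]
    refine ((continuousOn_twoPt Δ (0 : Fin 2) 1).mul continuousOn_aniso).congr fun x hx => ?_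
    rw [anisoFamily_two, anisoPair, if_neg hx]
    rfl
  · refine (continuousOn_const (c := (0 : ℝ))).congr fun x _ => ?_
    exact anisoFamily_ne_two Δ hn x

/-- `aniso` is invariant under every origin-centred sphere inversion. -/
theorem aniso_sphereInversion {lam : ℝ} (hlam : 0 < lam) {x y : EuclideanSpace ℝ (Fin 3)} (hx : x ≠ 0) (hy : y ≠ 0) :
    aniso ((lam / ‖x‖ ^ 2) • x) ((lam / ‖y‖ ^ 2) • y) = aniso x y := by
  unfold aniso
  have hnx : 0 < ‖x‖ := norm_pos_iff.2 hx
  have hny : 0 < ‖y‖ := norm_pos_iff.2 hy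
  rw [norm_sphereInversion hlam hx, norm_sphereInversion hlam hy, real_inner_smul_left,
    real_inner_smul_left]
  congr 1
  field_simp
  ring

/-- `aniso` is dilation invariant. -/
theorem aniso_smul {c : ℝ} (hc : 0 < c) (x y : EuclideanSpace ℝ (Fin 3)) : aniso (c • x) (c • y) = aniso x y := by
  unfold aniso
  by_cases h : ‖x‖ ^ 2 + ‖y‖ ^ 2 = 0
  · have h1 : ‖x‖ ^ 2 = 0 := by nlinarith [sq_nonneg ‖x‖, sq_nonneg ‖y‖]
    have h2 : ‖y‖ ^ 2 = 0 := by nlinarith [sq_nonneg ‖x‖, sq_nonneg ‖y‖]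
    rw [sq_eq_zero_iff, norm_eq_zero] at h1 h2
    subst h1; subst h2
    simp
  · rw [norm_smul, norm_smul, real_inner_smul_left, real_inner_smul_left, Real.norm_eq_abs,
      abs_of_pos hc]
    congr 1
    have hc0 : c ≠ 0 := hc.ne'
    field_simp

/-- **The witness is covariant under every origin-centred sphere inversion**, weight `Δ`. -/
theorem anisoFamily_mem_sphereInversionCovariant (Δ : ℝ) :
    anisoFamily Δ ∈ sphereInversionCovariant Δ := by
  simp only [sphereInversionCovariant, Set.mem_setOf_eq]
  intro n lam hlam x hx
  by_cases hn : n = 2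
  · subst hn
    rw [anisoFamily_two, anisoFamily_two, anisoPair, anisoPair]
    by_cases h01 : x 0 = x 1
    · -- diagonal: both sides vanish
      rw [if_pos (by rw [h01]), if_pos h01, mul_zero]
    · have h01' : (lam / ‖x 0‖ ^ 2) • x 0 ≠ (lam / ‖x 1‖ ^ 2) • x 1 :=
        fun h => h01 (sphereInversion_injective hlam.ne' h)
      rw [if_neg h01', if_neg h01, aniso_sphereInversion hlam (hx 0) (hx 1),
        sphereInversion_eq_smul_inversion, sphereInversion_eq_smul_inversion, twoPt_smul Δ hlam,
        twoPt_inversion Δ (hx 0) (hx 1), Fin.prod_univ_two]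
      have e : (-((2 : ℕ) : ℝ) * Δ) = -(2 * Δ) := by push_cast; ring
      rw [e]
      ring
  · rw [anisoFamily_ne_two Δ hn, anisoFamily_ne_two Δ hn, mul_zero]

/-- The witness is moreover scale covariant with dimension `Δ` (so P2 minus translations fails even with
scale covariance thrown in). -/
theorem anisoFamily_isScaleCovariant (Δ : ℝ) : IsScaleCovariant Δ (anisoFamily Δ) := by
  intro n c hc x
  by_cases hn : n = 2
  · subst hn
    rw [anisoFamily_two, anisoFamily_two, anisoPair, anisoPair]
    by_cases h01 : x 0 = x 1
    · rw [if_pos (by rw [h01]), if_pos h01, mul_zero]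
    · have h01' : c • x 0 ≠ c • x 1 := fun h => h01 (smul_right_injective (EuclideanSpace ℝ (Fin 3)) hc.ne' h)
      rw [if_neg h01', if_neg h01, aniso_smul hc, twoPt_smul Δ hc]
      have e : (-((2 : ℕ) : ℝ) * Δ) = -(2 * Δ) := by push_cast; ring
      rw [e]
      ring
  · rw [anisoFamily_ne_two Δ hn, anisoFamily_ne_two Δ hn, mul_zero]

/-- The test pair `(e₁, 2e₁)`. -/
def testPair : Fin 2 → EuclideanSpace ℝ (Fin 3) := ![axisUnit, (2 : ℝ) • axisUnit]

/-- First point of the test pair. -/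
theorem testPair_zero : testPair 0 = axisUnit := rfl
/-- Second point of the test pair. -/
theorem testPair_one : testPair 1 = (2 : ℝ) • axisUnit := rfl

/-- `e₁ ≠ 2e₁`. -/
theorem axisUnit_ne_two_smul : axisUnit ≠ (2 : ℝ) • axisUnit := by
  intro h
  have h2 : (1 : ℝ) • axisUnit = (2 : ℝ) • axisUnit := by rwa [one_smul]
  have := smul_left_injective ℝ axisUnit_ne_zero h2
  norm_num at this

/-- `⟪e₁, e₁⟫ = 1`. -/
theorem inner_axisUnit_self : inner ℝ axisUnit axisUnit = (1 : ℝ) := by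
  rw [real_inner_self_eq_norm_sq, norm_axisUnit, one_pow]

/-- `aniso (e₁, 2e₁) = 9/5`. -/
theorem aniso_testPair : aniso axisUnit ((2 : ℝ) • axisUnit) = 9 / 5 := by
  unfold aniso
  rw [norm_smul, real_inner_smul_left, inner_axisUnit_self, norm_axisUnit, Real.norm_eq_abs,
    abs_of_pos two_pos]
  norm_num

/-- `aniso (−e₁, −2e₁) = 1/5`. -/
theorem aniso_neg_testPair : aniso (-axisUnit) (-((2 : ℝ) • axisUnit)) = 1 / 5 := by
  unfold aniso
  rw [norm_neg, norm_neg, norm_smul, inner_neg_left, inner_neg_left, real_inner_smul_left,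
    inner_axisUnit_self, norm_axisUnit, Real.norm_eq_abs, abs_of_pos two_pos]
  norm_num

/-- The reflected test pair `(−e₁, −2e₁)`. -/
def negTestPair : Fin 2 → EuclideanSpace ℝ (Fin 3) := ![-axisUnit, -((2 : ℝ) • axisUnit)]

/-- `S₂(e₁, 2e₁) = (9/5)·‖e₁‖^{-2Δ}` but `S₂(−e₁, −2e₁) = (1/5)·‖e₁‖^{-2Δ}`: the values differ. -/
theorem anisoFamily_negTestPair_ne (Δ : ℝ) : anisoFamily Δ 2 negTestPair ≠ anisoFamily Δ 2 testPair := by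
  intro key
  rw [anisoFamily_two, anisoFamily_two] at key
  simp only [negTestPair, testPair, Matrix.cons_val_zero, Matrix.cons_val_one] at key
  rw [anisoPair, anisoPair, if_neg (neg_injective.ne axisUnit_ne_two_smul), if_neg axisUnit_ne_two_smul,
    aniso_neg_testPair, aniso_testPair] at key
  have ht : twoPt Δ (-axisUnit) (-((2 : ℝ) • axisUnit)) = twoPt Δ axisUnit ((2 : ℝ) • axisUnit) := by
    have := twoPt_map Δ (LinearIsometryEquiv.neg ℝ) axisUnit ((2 : ℝ) • axisUnit)
    simpa using this
  rw [ht] at key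
  have hpos : 0 < twoPt Δ axisUnit ((2 : ℝ) • axisUnit) := twoPt_pos Δ axisUnit_ne_two_smul
  have : (1 / 5 : ℝ) = 9 / 5 := by
    have := mul_left_cancel₀ hpos.ne' key
    linarith
  norm_num at this

/-- **The witness is NOT `O(3)` invariant**: already the point reflection `x ↦ −x` (a linear isometry of
`ℝ³`, an element of `O(3)`) maps `(e₁, 2e₁)` to `(−e₁, −2e₁)`. -/
theorem anisoFamily_not_isRotationInvariant (Δ : ℝ) : ¬ IsRotationInvariant (anisoFamily Δ) := by
  intro h
  have key := h 2 (LinearIsometryEquiv.neg ℝ) testPair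
  have hcfg : (fun i => (LinearIsometryEquiv.neg ℝ : EuclideanSpace ℝ (Fin 3) ≃ₗᵢ[ℝ] EuclideanSpace ℝ (Fin 3)) (testPair i)) = negTestPair := by
    funext i
    fin_cases i <;> simp [testPair, negTestPair]
  rw [hcfg] at key
  exact anisoFamily_negTestPair_ne Δ key

/-- **P2 needs translation invariance**: the card's `GroupLemma` with `IsTranslationInvariant S` deleted is
FALSE (refuted at the Ising-window weight `Δ = 1/2`; the witness works for every `Δ`, next theorem). -/
theorem not_groupLemma_without_translation :
    ¬ ∀ (Δ : ℝ) (S : CorrFamily 3),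
        (∀ n z, z ∉ NonCoincident 3 n → S n z = 0) →
        (∀ n, ContinuousOn (S n) (NonCoincident 3 n)) →
        S ∈ sphereInversionCovariant Δ → IsMoebiusCovariant Δ S := fun h =>
  anisoFamily_not_isRotationInvariant (1 / 2)
    (h (1 / 2) (anisoFamily (1 / 2)) (anisoFamily_eq_zero_of_not_mem _) (continuousOn_anisoFamily _)
      (anisoFamily_mem_sphereInversionCovariant _)).1.2

/-- Per-weight form: for EVERY `Δ`, the family `anisoFamily Δ` satisfies all hypotheses of P2 except
translation invariance — and scale covariance on top — yet is not Möbius covariant. -/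
theorem groupLemma_hypotheses_without_translation_insufficient (Δ : ℝ) :
    (∀ n z, z ∉ NonCoincident 3 n → anisoFamily Δ n z = 0) ∧
    (∀ n, ContinuousOn (anisoFamily Δ n) (NonCoincident 3 n)) ∧
    anisoFamily Δ ∈ sphereInversionCovariant Δ ∧ IsScaleCovariant Δ (anisoFamily Δ) ∧
    ¬ IsMoebiusCovariant Δ (anisoFamily Δ) :=
  ⟨anisoFamily_eq_zero_of_not_mem Δ, continuousOn_anisoFamily Δ, anisoFamily_mem_sphereInversionCovariant Δ,
    anisoFamily_isScaleCovariant Δ, fun h => anisoFamily_not_isRotationInvariant Δ h.1.2⟩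

end Summit.CriticalPhenomena.Ising3DConformalLimit.Theorems.MoebiusLimitOfTwoPointLaw.Negative

end
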